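import Summits.QuantumFields.BalabanUV.Beta.EriceRemainderEnclosureHistoryAutonomyComparisonZones
import Summits.QuantumFields.BalabanUV.Beta.EriceRemainderEnclosureHistoryAutonomyComparisonDropBound

/-!
# EriceRemainderEnclosureHistoryAutonomyComparisonZonesUniform — (E63b) PROFILE-BOUNDED HYPER-SEPARATED ZONES COMPARE AT ANY SIZE, UNIFORMLY IN THE
# NUMBER OF AGES: for `B(u) = b + L_0·u_0 + Σ_{k∈A} L_k·u_k` (ANY Markov weight `L_0 ≥ 0`; `L ≥ 0` on a finite set `A` of ages `≥ 1` partitioned into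
# zones, ages of different zones separated by the ratio `t`, every zone passing (E58b)'s profile condition with margin `q`) THE STEP holds as soon as
# **`(3q(N−1) + 4)·t ≤ 2·(1 − q)^N`**, `N` the number of ZONES — the number of ages no longer enters ((E62c) needed `(n² + 4)·t ≤ 2(1−q)^N`, `n = #A`,
# vacuous for dense blocks): by (E63a)'s a priori drop bound `(3∕2)·η` at every scale in place of (E62a)'s `n·(√2∕2)·η`, and profile weights in place of
# the acceleration constant in the erosion terms

Cell `pub-balaban`, β-function sub-cell, BINDER row D4 «RemainderConst leaves for Bałaban's split» (`HOME/BINDER-OWNERS.md`; owner lineage `b2b-balaban-beta-an4`;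
this file by co-owner #2 lineage `b2b-balaban-beta-d4-p2`, generation 56), β-FLOW TEAM duty (1), FREEZE (0) honoured (def-free; (E63a)'s `drop_le_three_halves` ∕
`old_drop_window_of_weight` ∕ `le_of_isotone_excess_of_step_below`, (E62c)'s `budget_prod` ∕ `pow_card_le_prod_of_le` ∕ `assembly_general`, (E62a)'s
`window_sum_ge`, (E58b)'s `weight_le_profile`, (E48a)'s `strictAnti_of_memFlow` ∕ `le_of_pin_le` ∕ `memFlow_tail`, (E49j)'s `excess_shift_le`, (E41)'s `affine_monotone` ∕
`affine_floor` ∕ `affine_zerothMoment`, node U2's `SeqBox` ∕ `MemFlow` ∕ `invSq_eq_of_memFlow` ∕ `mul_lower_le_drive` ∕ `Sharpness.abs_sub_le_half_cube_mul` BY NAME;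
nothing restated).  Sequel of (E62c) `…ComparisonZones`; corollaries for towers (singleton zones) in (E63c) `…ComparisonTowerUniform`.

HONEST FRAMING (page 1, verbatim and binding).  *"Discharging BetaPertH makes Bałaban's UV stability UNCONDITIONAL — a real constructive-QFT result; it is
NOT the continuum limit and NOT the Clay problem."*  THIS FILE DISCHARGES NOTHING OF THE KIND.  Elementary real analysis about ABSTRACT affine functionals on
a box ]0,γ]^ℕ with displayed supports, zones and signs — hypotheses of a census, not facts; the form, signs, ages and moments of Bałaban's (1.22) limit
functional are NOT PRINTED ([I] p. 298; GAPS G-t4-U2-1∕-2) and NOT asserted.  Row D4 class UNCHANGED (critical-path width 0; instance 0∕1; D4 DISCHARGE NO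
DATE).  HONEST DEPENDENCY: continuum YM on T⁴ ⇐ BetaPertH ∧ nine spine estimates (0/9 proved); BetaPertH ⇐ (D1) ∧ (D4) ∧ CAP+tail; G-an2-4 gates asym, D1
and NE2/3/4.

THE POINT (census sense (α); the COMPARISON column, conjecture (E58′)).  (E62c)'s STEP charges every row of its triangular system an erosion with
`D̄ = #A·(√2∕2)·η` (one acceleration constant per age at every scale), whence `(n² + 4)·t ≤ 2(1−q)^N` with `n` the number of AGES — vacuous for dense
blocks.  Two changes make the bookkeeping UNIFORM IN THE NUMBER OF AGES: (1) (E63a)'s A PRIORI DROP BOUND `dd_m ≤ (3∕2)·η` at every scale `m ≥ 1` for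
EVERY profile, available because (E61a)'s principle hands the STEP the order of the effective β-functions at every deeper orbit pin; (2) the erosion of an
older age `k′` is weighed by its PROFILE WEIGHT `q_{k′} = L_{k′}∕(2P_{k′})` ((E63a) `old_drop_window_of_weight`), and the weights of the older zones sum to
`≤ (N−1)·q`.  Rows `D_k ≤ q_k·(η₊ − (1−2t)·S_{>ζ})`, **`η₊ = η·(1 + (3∕2)q(N−1)t)`**; zone rows, (E62c)'s `budget_prod` and `assembly_general` (`E = 3q(N−1)`)
close THE STEP under **`(3q(N−1) + 4)·t ≤ 2·(1 − q)^N`** (§1, in (E61a)'s «deeper pins handed» form); (E63a)'s family-free principle gives §2.  A Markov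
weight `L_0` rides along for free (no drop at the pin, deeper drops only help, the a priori bound covers it).  Examples: dense block with margin `q = 0.8`
plus ONE far age: ratio `80` for ANY number of ages in the block ((E62c): `≳ 6·10⁴` at fifty ages); singleton zones: (E63c).  NOT CLAIMED: (E58′) at
intermediate ratios; any improvement of the per-zone factor `1 − q(1−2t)`; anything printed.

WHAT IS PROVED ([folklore]; 0 `def`, 0 sorry).  §1 `card_filter_lt_le`, **`effective_le_of_family_le_at_zones_uniform`** (THE STEP, deeper pins handed).  §2
**`le_of_isotone_excess_zones_uniform`**.
-/
noncomputable section
open Finset Set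

namespace Summit.QuantumFields.BalabanUV.Beta.EriceRemainderEnclosureHistoryAutonomyComparisonZonesUniform

open Literature.MathematicalPhysics.QuantumFieldTheory.Balaban1983to89
open Literature.MathematicalPhysics.QuantumFieldTheory.Balaban1983to89.T4BetaStationary
open Literature.MathematicalPhysics.QuantumFieldTheory.Balaban1983to89.T4BetaFlowWellPosed
open Literature.MathematicalPhysics.QuantumFieldTheory.Balaban1983to89.T4BetaFlowWellPosed.Sharpness (abs_sub_le_half_cube_mul)
open Summit.QuantumFields.BalabanUV.Beta.EriceRemainderEnclosureHistoryAutonomyOrder (strictAnti_of_memFlow le_of_pin_le memFlow_tail)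
open Summit.QuantumFields.BalabanUV.Beta.EriceRemainderEnclosureHistoryAutonomyComparisonExcess (excess_shift_le)
open Summit.QuantumFields.BalabanUV.Beta.EriceRemainderEnclosureHistoryAutonomyMonotone (affine_monotone affine_floor affine_zerothMoment)
open Summit.QuantumFields.BalabanUV.Beta.EriceRemainderEnclosureHistoryAutonomyComparisonAffineProfile (weight_le_profile)
open Summit.QuantumFields.BalabanUV.Beta.EriceRemainderEnclosureHistoryAutonomyComparisonTowerLemmas (window_sum_ge)
open Summit.QuantumFields.BalabanUV.Beta.EriceRemainderEnclosureHistoryAutonomyComparisonZones (budget_prod pow_card_le_prod_of_le assembly_general)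
open Summit.QuantumFields.BalabanUV.Beta.EriceRemainderEnclosureHistoryAutonomyComparisonDropBound
  (drop_le_three_halves old_drop_window_of_weight le_of_isotone_excess_of_step_below)

variable {B' : (ℕ → ℝ) → ℝ} {M' γ b y t q : ℝ} {L : ℕ → ℝ} {K : ℕ} {h h' : ℕ → ℝ} {A : Finset ℕ} {z : ℕ → ℕ} {S S' : ℝ → ℕ → ℝ}

/-! ## §1 THE STEP for profile-bounded hyper-separated zones, uniformly in the number of ages, with the deeper pins handed -/

/-- The elements of `Z` above `ζ ∈ Z` number at most `#Z − 1`. [folklore] -/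
theorem card_filter_lt_le {Z : Finset ℕ} {ζ : ℕ} (hζ : ζ ∈ Z) : ((Z.filter (fun ζ' => ζ < ζ')).card : ℝ) ≤ (Z.card : ℝ) - 1 := by
  have hsub : Z.filter (fun ζ' => ζ < ζ') ⊆ Z.erase ζ := fun ζ' hζ' =>
    Finset.mem_erase.mpr ⟨ne_of_gt (mem_filter.mp hζ').2, (mem_filter.mp hζ').1⟩
  have h1 := Finset.card_le_card hsub
  rw [Finset.card_erase_of_mem hζ] at h1
  have hZ1 : 1 ≤ Z.card := card_pos.mpr ⟨ζ, hζ⟩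
  have : ((Z.filter (fun ζ' => ζ < ζ')).card : ℝ) ≤ ((Z.card - 1 : ℕ) : ℝ) := by exact_mod_cast h1
  rwa [Nat.cast_sub hZ1, Nat.cast_one] at this

/-- **THE STEP FOR PROFILE-BOUNDED HYPER-SEPARATED ZONES, UNIFORM IN THE NUMBER OF AGES (deeper pins handed).**  `B(u) = b + Σ_{k<K} L_k·u_k` with `L ≥ 0`
supported on `{0} ∪ A`, `A ⊆ [1, K[` finite (the Markov weight `L_0` ARBITRARY); a zone map `z`; ages of different zones separated, `k ≤ t·k′` whenever
`z k < z k′` (`t ≥ 0`); every zone passing the profile condition with margin `q ∈ [0,1]`, `Σ_{j∈A, z j = ζ} L_j ∕ P_j ≤ 2q`, `P_j = Σ_{k<K} L_k·√(j∕(j+k))`; and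
**`(3q(N−1) + 4)·t ≤ 2·(1 − q)^N`**, `N = #z(A)` — NO condition on `#A`.  `B′` with zeroth moment `M′ ≥ 0`, `B ≤ B′` on the box with ISOTONE excess; unique
solution families `S`, `S′`; a pin `y ∈ ]0,γ]` at which the effective β-functions are ordered and the families compare at every pin at least one floor step
deeper ((E61a)'s induction hypothesis); `h`, `h′` box solutions of `B`, `B′` from `y` with `h′ ≤ h`.  Then `B h ≤ B′ h′`. [folklore] -/
theorem effective_le_of_family_le_at_zones_uniform (hL : ∀ k, 0 ≤ L k) (hb : 0 < b) (hAK : A ⊆ range K) (hA1 : ∀ k ∈ A, 1 ≤ k)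
    (hsupp : ∀ k ∈ range K, k ∉ A → k ≠ 0 → L k = 0) (ht0 : 0 ≤ t) (hsep : ∀ k ∈ A, ∀ k' ∈ A, z k < z k' → (k : ℝ) ≤ t * k')
    (hq0 : 0 ≤ q) (hq1 : q ≤ 1)
    (hzone : ∀ ζ ∈ A.image z, ∑ j ∈ A.filter (fun j => z j = ζ), L j / ∑ k ∈ range K, L k * Real.sqrt ((j : ℝ) / ((j : ℝ) + k)) ≤ 2 * q)
    (ht : (3 * q * (((A.image z).card : ℝ) - 1) + 4) * t ≤ 2 * (1 - q) ^ (A.image z).card)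
    (hB' : ∀ u u' : ℕ → ℝ, SeqBox γ u → SeqBox γ u' → ∀ D : ℝ, (∀ j, |u j - u' j| ≤ D) → |B' u - B' u'| ≤ M' * D) (hM' : 0 ≤ M')
    (hexc : ∀ u, SeqBox γ u → (fun u : ℕ → ℝ => b + ∑ k ∈ range K, L k * u k) u ≤ B' u)
    (hDmono : ∀ u v : ℕ → ℝ, SeqBox γ u → SeqBox γ v → (∀ j, u j ≤ v j) →
      B' u - (fun u : ℕ → ℝ => b + ∑ k ∈ range K, L k * u k) u ≤ B' v - (fun u : ℕ → ℝ => b + ∑ k ∈ range K, L k * u k) v)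
    (hS : ∀ p, 0 < p → p ≤ γ → SeqBox γ (S p) ∧ MemFlow (fun u : ℕ → ℝ => b + ∑ k ∈ range K, L k * u k) p (S p))
    (huniq : ∀ p, 0 < p → p ≤ γ → ∀ u u' : ℕ → ℝ, SeqBox γ u → SeqBox γ u' →
      MemFlow (fun u : ℕ → ℝ => b + ∑ k ∈ range K, L k * u k) p u → MemFlow (fun u : ℕ → ℝ => b + ∑ k ∈ range K, L k * u k) p u' → u = u')
    (hS' : ∀ p, 0 < p → p ≤ γ → SeqBox γ (S' p) ∧ MemFlow B' p (S' p))
    (huniq' : ∀ p, 0 < p → p ≤ γ → ∀ u u' : ℕ → ℝ, SeqBox γ u → SeqBox γ u' → MemFlow B' p u → MemFlow B' p u' → u = u')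
    (hy : 0 < y) (hyγ : y ≤ γ)
    (hdeep : ∀ w, 0 < w → w ≤ γ → 1 / y ^ 2 + b ≤ 1 / w ^ 2 →
      (fun u : ℕ → ℝ => b + ∑ k ∈ range K, L k * u k) (S w) ≤ B' (S' w) ∧ ∀ j, S' w j ≤ S w j)
    (hh : SeqBox γ h) (hf : MemFlow (fun u : ℕ → ℝ => b + ∑ k ∈ range K, L k * u k) y h) (hh' : SeqBox γ h')
    (hf' : MemFlow B' y h') (hle : ∀ j, h' j ≤ h j) :
    (fun u : ℕ → ℝ => b + ∑ k ∈ range K, L k * u k) h ≤ B' h' := by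
  set B : (ℕ → ℝ) → ℝ := fun u : ℕ → ℝ => b + ∑ k ∈ range K, L k * u k with hB_def
  have hmono : ∀ u v : ℕ → ℝ, SeqBox γ u → SeqBox γ v → (∀ j, u j ≤ v j) → B u ≤ B v := affine_monotone hL
  have hlo : ∀ u, SeqBox γ u → b ≤ B u := affine_floor hL
  have hlo' : ∀ u, SeqBox γ u → b ≤ B' u := fun u hu => (hlo u hu).trans (hexc u hu)
  have hmono' : ∀ u v : ℕ → ℝ, SeqBox γ u → SeqBox γ v → (∀ j, u j ≤ v j) → B' u ≤ B' v := fun u v hu hv huv => by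
    linarith [hDmono u v hu hv huv, hmono u v hu hv huv]
  have hdom : ∀ u, SeqBox γ u → ∑ k ∈ range K, L k * u k ≤ B u := fun u _ => by simp only [hB_def]; linarith
  have hdropL : ∀ u u' : ℕ → ℝ, SeqBox γ u → SeqBox γ u' → (∀ j, u' j ≤ u j) → B u - B u' ≤ ∑ k ∈ range K, L k * (u k - u' k) := by
    intro u u' _ _ _; simp only [hB_def]; rw [add_sub_add_left_eq_sub, ← sum_sub_distrib]
    exact le_of_eq (sum_congr rfl fun k _ => by ring)
  have hanti' : Antitone h' := (strictAnti_of_memFlow hb hlo' hh' hf').antitone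
  -- the excess at the pin and along h′
  set η : ℝ := B' h' - B h' with hη_def
  have hη0 : 0 ≤ η := by rw [hη_def]; linarith [hexc h' hh']
  have hηs : ∀ n, |B (fun j => h' (n + 1 + j)) - B' (fun j => h' (n + 1 + j))| ≤ η := excess_shift_le hexc hDmono hh' hanti'
  -- gaps and level gaps
  have hg0 : ∀ n, 0 ≤ h n - h' n := fun n => by linarith [hle n]
  set δ : ℕ → ℝ := fun n => 1 / h' n ^ 2 - 1 / h n ^ 2 with hδ_def
  have hδ0 : ∀ n, 0 ≤ δ n := fun n =>
    sub_nonneg.mpr (one_div_le_one_div_of_le (pow_pos (hh' n).1 2) (pow_le_pow_left₀ (hh' n).1.le (hle n) 2))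
  have hgδ : ∀ n, h n - h' n ≤ h n ^ 3 / 2 * δ n := by
    intro n; have hw := abs_sub_le_half_cube_mul (hh n).1 (hh' n).1 le_rfl (hle n)
    rwa [abs_of_nonneg (hg0 n), abs_sub_comm, abs_of_nonneg (hδ0 n)] at hw
  -- the drop read at scale n (the full profile, Markov weight included)
  set dd : ℕ → ℝ := fun n => ∑ k ∈ range K, L k * (h (n + k) - h' (n + k)) with hdd_def
  have hdrop_eq : ∀ n, B (fun j => h (n + j)) - B (fun j => h' (n + j)) = dd n := by
    intro n; simp only [hB_def, hdd_def]; rw [add_sub_add_left_eq_sub, ← sum_sub_distrib]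
    exact sum_congr rfl fun x _ => by ring
  have hdd0 : ∀ n, 0 ≤ dd n := fun n => sum_nonneg fun k _ => mul_nonneg (hL k) (hg0 _)
  -- the increment identity
  have hinc : ∀ n, δ (n + 1) - δ n ≤ η - dd (n + 1) ∧ -dd (n + 1) ≤ δ (n + 1) - δ n := by
    intro n
    have e1 := hf.2 n; have e2 := hf'.2 n; have hd := hdrop_eq (n + 1); have ex1 := (abs_le.mp (hηs n)).1
    have ex0 : B (fun j => h' (n + 1 + j)) ≤ B' (fun j => h' (n + 1 + j)) := hexc _ (seqBox_shift hh' (n + 1))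
    simp only [hδ_def]; constructor <;> linarith
  have hδ_zero : δ 0 = 0 := by simp only [hδ_def]; rw [hf.1, hf'.1]; ring
  have hδle : ∀ n : ℕ, δ n ≤ (n : ℝ) * η := by
    intro n
    induction n with
    | zero => rw [hδ_zero]; simp
    | succ n ih => have := (hinc n).1; have := hdd0 (n + 1); rw [Nat.cast_succ]; linarith
  have hδup : ∀ m : ℕ, δ m ≤ (m : ℝ) * η - ∑ l ∈ range m, dd (l + 1) := by
    intro m
    induction m with
    | zero => rw [hδ_zero]; simp
    | succ m ih => have := (hinc m).1; rw [Nat.cast_succ, sum_range_succ]; linarith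
  have hδdown : ∀ n l : ℕ, δ n - ∑ i ∈ range l, dd (n + 1 + i) ≤ δ (n + l) := by
    intro n l
    induction l with
    | zero => simp
    | succ l ih =>
      have := (hinc (n + l)).2
      rw [sum_range_succ, show n + (l + 1) = n + l + 1 by ring, show n + 1 + l = n + l + 1 by ring]; linarith
  -- THE A PRIORI DROP BOUND at every scale m + 1, from the order at the deeper orbit pin h(m+1)
  have he' : h' = S' y := huniq' y hy hyγ _ _ hh' (hS' y hy hyγ).1 hf' (hS' y hy hyγ).2
  have hDbar : ∀ m, dd (m + 1) ≤ 3 / 2 * η := by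
    intro m
    have hm := hh (m + 1); have hm' := hh' (m + 1)
    -- the deeper pin is at least one floor step deeper
    have hlev : 1 / y ^ 2 + b ≤ 1 / h (m + 1) ^ 2 := by
      rw [invSq_eq_of_memFlow hf (m + 1)]
      have := mul_lower_le_drive hlo hh (m + 1); have h1 : (1 : ℝ) ≤ ((m + 1 : ℕ) : ℝ) := by exact_mod_cast Nat.succ_pos m
      nlinarith
    obtain ⟨horder, hcmp⟩ := hdeep (h (m + 1)) hm.1 hm.2 hlev
    have et : (fun j => h (m + 1 + j)) = S (h (m + 1)) :=
      huniq _ hm.1 hm.2 _ _ (seqBox_shift hh (m + 1)) (hS _ hm.1 hm.2).1 (memFlow_tail hf (m + 1)) (hS _ hm.1 hm.2).2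
    have et' : (fun j => h' (m + 1 + j)) = S' (h' (m + 1)) :=
      huniq' _ hm'.1 hm'.2 _ _ (seqBox_shift hh' (m + 1)) (hS' _ hm'.1 hm'.2).1 (memFlow_tail hf' (m + 1)) (hS' _ hm'.1 hm'.2).2
    have hkS := hS' _ hm.1 hm.2
    have hkle : ∀ j, S' (h (m + 1)) j ≤ h (m + 1 + j) := fun j => by have := hcmp j; rwa [← et] at this
    have hkge : ∀ j, h' (m + 1 + j) ≤ S' (h (m + 1)) j := fun j => by
      have := le_of_pin_le hb hB' hM' hlo' huniq' hm'.1 (hle (m + 1)) hm.2 (hS' _ hm'.1 hm'.2).1 hkS.1 (hS' _ hm'.1 hm'.2).2 hkS.2 j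
      rwa [← et'] at this
    have horder' : B (fun j => h (m + 1 + j)) ≤ B' (S' (h (m + 1))) := by rw [et]; exact horder
    -- the excess along the deeper B′-trajectory is at most η (it lies below h′ = S′ y)
    have hkh' : ∀ j, S' (h (m + 1)) j ≤ h' j := fun j => by
      rw [he']
      exact le_of_pin_le hb hB' hM' hlo' huniq' hm.1 ((strictAnti_of_memFlow hb hlo hh hf).antitone (Nat.zero_le _) |>.trans_eq hf.1)
        hyγ hkS.1 (hS' y hy hyγ).1 hkS.2 (hS' y hy hyγ).2 j
    have hE : B' (S' (h (m + 1))) - B (S' (h (m + 1))) ≤ η := by rw [hη_def]; exact hDmono _ _ hkS.1 hh' hkh'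
    have h32 := drop_le_three_halves hmono hL hb hlo hdom hdropL hmono' hy hh hf hh' hf' m hkS.1 hkS.2 hkle hkge horder' hE
      (by have := hδle (m + 1); simpa only [hδ_def] using this)
    rw [← hdrop_eq (m + 1)]; exact h32
  -- the zones
  set Z : Finset ℕ := A.image z with hZ_def
  have hmaps : ∀ k ∈ A, z k ∈ Z := fun k hk => mem_image_of_mem z hk
  set E : ℝ := 3 * q * ((Z.card : ℝ) - 1) with hE_def
  -- the numerical side condition 0 ≤ 1 − 2t
  have hZq : A.Nonempty → 0 ≤ E := by
    intro ⟨k, hk⟩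
    have : (1 : ℝ) ≤ Z.card := by exact_mod_cast card_pos.mpr ⟨z k, hmaps k hk⟩
    simp only [hE_def]; nlinarith
  have hpowle : (1 - q) ^ Z.card ≤ 1 := pow_le_one₀ (by linarith) (by linarith)
  -- constants: the uniform drop bound D̄ = (3/2)η; the enlarged budget η₊ = η(1 + E t/2)
  set Dbar : ℝ := 3 / 2 * η with hDbar_def
  have hDbar0 : 0 ≤ Dbar := by positivity
  set ηp : ℝ := η * (1 + E * t / 2) with hηp_def
  -- the drops at the pin, per age and per zone; the profile weights
  set Dk : ℕ → ℝ := fun k => L k * (h k - h' k) with hDk_def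
  have hDk0 : ∀ k, 0 ≤ Dk k := fun k => mul_nonneg (hL k) (hg0 k)
  have hP0 : ∀ j : ℕ, 0 ≤ ∑ k ∈ range K, L k * Real.sqrt ((j : ℝ) / ((j : ℝ) + k)) :=
    fun j => sum_nonneg fun k _ => mul_nonneg (hL k) (Real.sqrt_nonneg _)
  set qk : ℕ → ℝ := fun j => L j / (∑ k ∈ range K, L k * Real.sqrt ((j : ℝ) / ((j : ℝ) + k))) / 2 with hqk_def
  have hqk0 : ∀ k, 0 ≤ qk k := fun k => by simp only [hqk_def]; exact div_nonneg (div_nonneg (hL k) (hP0 k)) (by norm_num)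
  -- the profile weight bounds the coupling weight of every age: L_k·h_k³/2 ≤ q_k/k
  have hqw : ∀ k ∈ A, L k * (h k ^ 3 / 2) ≤ qk k / k := by
    intro k hk
    have hkr : (0 : ℝ) < k := by exact_mod_cast hA1 k hk
    have hwp := weight_le_profile (affine_monotone hL) hL hb hlo hdom hy hh hf (hAK hk)
    have e : L k * (h k ^ 3 / 2) = L k * k * h k ^ 3 / (2 * k) := by rw [eq_div_iff (by positivity)]; ring
    rw [e, show qk k / k = L k / (∑ k' ∈ range K, L k' * Real.sqrt ((k : ℝ) / ((k : ℝ) + k'))) / (2 * k) by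
      simp only [hqk_def]; rw [div_div]]
    exact div_le_div_of_nonneg_right hwp (by positivity)
  set DZ : ℕ → ℝ := fun ζ => ∑ k ∈ A.filter (fun k => z k = ζ), Dk k with hDZ_def
  set QZ : ℕ → ℝ := fun ζ => ∑ k ∈ A.filter (fun k => z k = ζ), qk k with hQZ_def
  have hDZ0 : ∀ ζ, 0 ≤ DZ ζ := fun ζ => sum_nonneg fun k _ => hDk0 k
  have hQZ0 : ∀ ζ, 0 ≤ QZ ζ := fun ζ => sum_nonneg fun k _ => hqk0 k
  have hQZq : ∀ ζ ∈ Z, QZ ζ ≤ q := by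
    intro ζ hζ
    have e : QZ ζ = (∑ j ∈ A.filter (fun j => z j = ζ),
        L j / ∑ k ∈ range K, L k * Real.sqrt ((j : ℝ) / ((j : ℝ) + k))) / 2 := by simp only [hQZ_def, hqk_def]; rw [sum_div]
    rw [e]; linarith [hzone ζ hζ]
  -- the drop at the pin is carried by the ages of A (the Markov term reads the common pin)
  have hdrop0 : B h - B h' = ∑ k ∈ A, Dk k := by
    have := hdrop_eq 0
    simp only [hdd_def, zero_add] at this
    rw [this]
    simp only [hDk_def]
    refine (sum_subset hAK fun k hk hkA => ?_).symm
    rcases Nat.eq_zero_or_pos k with rfl | hkpos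
    · rw [hf.1, hf'.1, sub_self, mul_zero]
    · rw [hsupp k hk hkA (Nat.pos_iff_ne_zero.mp hkpos), zero_mul]
  -- the older-zone totals seen by zone ζ: drops and profile weights
  set Sd : ℕ → ℝ := fun ζ => ∑ k' ∈ A.filter (fun k' => ζ < z k'), Dk k' with hSd_def
  set Sq : ℕ → ℝ := fun ζ => ∑ k' ∈ A.filter (fun k' => ζ < z k'), qk k' with hSq_def
  have hfib : ∀ (f : ℕ → ℝ) (ζ : ℕ), ∑ k' ∈ A.filter (fun k' => ζ < z k'), f k'
      = ∑ ζ' ∈ Z.filter (fun ζ' => ζ < ζ'), ∑ k ∈ A.filter (fun k => z k = ζ'), f k := by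
    intro f ζ
    rw [← sum_fiberwise_of_maps_to (s := A.filter (fun k' => ζ < z k')) (t := Z.filter (fun ζ' => ζ < ζ')) (g := z)
      (fun k' hk' => by
        obtain ⟨hk'A, hζ⟩ := mem_filter.mp hk'
        exact mem_filter.mpr ⟨hmaps k' hk'A, hζ⟩)]
    refine sum_congr rfl fun ζ' hζ' => ?_
    obtain ⟨-, hζζ'⟩ := mem_filter.mp hζ'
    refine sum_congr ?_ fun _ _ => rfl
    ext k'
    simp only [mem_filter]
    exact ⟨fun ⟨⟨hk'A, _⟩, hz⟩ => ⟨hk'A, hz⟩, fun ⟨hk'A, hz⟩ => ⟨⟨hk'A, hz.symm ▸ hζζ'⟩, hz⟩⟩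
  have hSqle : ∀ ζ ∈ Z, Sq ζ ≤ ((Z.card : ℝ) - 1) * q := by
    intro ζ hζ
    have e : Sq ζ = ∑ ζ' ∈ Z.filter (fun ζ' => ζ < ζ'), QZ ζ' := by simp only [hSq_def, hQZ_def]; exact hfib qk ζ
    rw [e]
    calc ∑ ζ' ∈ Z.filter (fun ζ' => ζ < ζ'), QZ ζ' ≤ ∑ _ζ' ∈ Z.filter (fun ζ' => ζ < ζ'), q :=
          sum_le_sum fun ζ' hζ' => hQZq ζ' (mem_of_mem_filter ζ' hζ')
      _ = ((Z.filter (fun ζ' => ζ < ζ')).card : ℝ) * q := by rw [sum_const, nsmul_eq_mul]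
      _ ≤ ((Z.card : ℝ) - 1) * q := mul_le_mul_of_nonneg_right (card_filter_lt_le hζ) hq0
  -- PER AGE: D_k ≤ q_k·(η₊ − (1 − 2t)·Sd(z k))
  have hage : ∀ k ∈ A, Dk k ≤ qk k * (ηp - (1 - 2 * t) * Sd (z k)) := by
    intro k hk
    have hkr : (0 : ℝ) < k := by exact_mod_cast hA1 k hk
    -- (i) D_k ≤ (q_k/k)·δ_k by the profile weight
    have h1 : Dk k ≤ qk k / k * δ k := by
      calc Dk k = L k * (h k - h' k) := by simp only [hDk_def]
        _ ≤ L k * (h k ^ 3 / 2 * δ k) := mul_le_mul_of_nonneg_left (hgδ k) (hL k)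
        _ = L k * (h k ^ 3 / 2) * δ k := by ring
        _ ≤ qk k / k * δ k := mul_le_mul_of_nonneg_right (hqw k hk) (hδ0 k)
    -- (ii) δ_k ≤ k·η − Σ_{l<k} dd(l+1)
    have h2 := hδup k
    -- (iii) over the window every age of a higher zone drops by at least (1−2t)·D_{k′} − q_{k′}·t·D̄
    have hW : ∀ l ∈ range k, (1 - 2 * t) * Sd (z k) - t * Dbar * Sq (z k) ≤ dd (l + 1) := by
      intro l hl
      have hl' : l + 1 ≤ k := mem_range.mp hl
      have hold : ∀ k' ∈ A.filter (fun k' => z k < z k'),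
          (1 - 2 * t) * Dk k' - qk k' * t * Dbar ≤ L k' * (h (l + 1 + k') - h' (l + 1 + k')) := by
        intro k' hk'
        obtain ⟨hk'A, hkk'⟩ := mem_filter.mp hk'
        have hk'1 := hA1 k' hk'A
        have hlt : ((l + 1 : ℕ) : ℝ) ≤ t * k' := le_trans (by exact_mod_cast hl') (hsep k hk k' hk'A hkk')
        have hEr : ∑ i ∈ range (l + 1), dd (k' + 1 + i) ≤ ((l + 1 : ℕ) : ℝ) * Dbar := by
          calc ∑ i ∈ range (l + 1), dd (k' + 1 + i) ≤ ∑ _i ∈ range (l + 1), Dbar :=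
                sum_le_sum fun i _ => by rw [show k' + 1 + i = (k' + i) + 1 by ring]; exact hDbar _
            _ = ((l + 1 : ℕ) : ℝ) * Dbar := by rw [sum_const, card_range, nsmul_eq_mul]
        have hlev : δ k' - ((l + 1 : ℕ) : ℝ) * Dbar ≤ δ (k' + (l + 1)) := by linarith [hδdown k' (l + 1)]
        have hwin := old_drop_window_of_weight hL hb hy hh hf hh' hle hk'1 l hlt hDbar0 (hqw k' hk'A)
          (by simp only [hδ_def] at hlev; exact hlev)
        rw [show l + 1 + k' = k' + (l + 1) by ring]; simp only [hDk_def]; exact hwin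
      have hsumold := sum_le_sum hold
      have hsub : ∑ k' ∈ A.filter (fun k' => z k < z k'), L k' * (h (l + 1 + k') - h' (l + 1 + k')) ≤ dd (l + 1) := by
        simp only [hdd_def]
        exact sum_le_sum_of_subset_of_nonneg ((filter_subset _ _).trans hAK) fun k' _ _ => mul_nonneg (hL k') (hg0 _)
      have hcount : ∑ k' ∈ A.filter (fun k' => z k < z k'), ((1 - 2 * t) * Dk k' - qk k' * t * Dbar)
          = (1 - 2 * t) * Sd (z k) - t * Dbar * Sq (z k) := by
        simp only [hSd_def, hSq_def]
        rw [sum_sub_distrib, ← mul_sum, mul_sum (Finset.filter _ A) (fun i => qk i) (t * Dbar)]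
        congr 1
        exact sum_congr rfl fun k' _ => by ring
      linarith
    -- (iv) the window sum and the row of the system
    have h4 := window_sum_ge hW
    have hSq' : t * Dbar * Sq (z k) ≤ t * Dbar * (((Z.card : ℝ) - 1) * q) :=
      mul_le_mul_of_nonneg_left (hSqle (z k) (hmaps k hk)) (by positivity)
    have h5 : Dk k ≤ qk k / k * ((k : ℝ) * (η + t * Dbar * (((Z.card : ℝ) - 1) * q) - (1 - 2 * t) * Sd (z k))) := by
      refine h1.trans (mul_le_mul_of_nonneg_left ?_ (div_nonneg (hqk0 k) hkr.le))
      have : (k : ℝ) * (η + t * Dbar * (((Z.card : ℝ) - 1) * q) - (1 - 2 * t) * Sd (z k))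
          = (k : ℝ) * η - (k : ℝ) * ((1 - 2 * t) * Sd (z k) - t * Dbar * (((Z.card : ℝ) - 1) * q)) := by ring
      rw [this]
      have hkw : (k : ℝ) * ((1 - 2 * t) * Sd (z k) - t * Dbar * (((Z.card : ℝ) - 1) * q))
          ≤ (k : ℝ) * ((1 - 2 * t) * Sd (z k) - t * Dbar * Sq (z k)) := mul_le_mul_of_nonneg_left (by linarith) hkr.le
      linarith
    have e1 : qk k / k * ((k : ℝ) * (η + t * Dbar * (((Z.card : ℝ) - 1) * q) - (1 - 2 * t) * Sd (z k)))
        = qk k * (η + t * Dbar * (((Z.card : ℝ) - 1) * q) - (1 - 2 * t) * Sd (z k)) := by field_simp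
    have e2 : qk k * (η + t * Dbar * (((Z.card : ℝ) - 1) * q) - (1 - 2 * t) * Sd (z k)) = qk k * (ηp - (1 - 2 * t) * Sd (z k)) := by
      simp only [hηp_def, hDbar_def, hE_def]; ring
    linarith
  -- PER ZONE: D_ζ ≤ Q_ζ·η₊ − Q_ζ(1 − 2t)·Σ_{ζ′>ζ} D_{ζ′}
  have hSZ : ∀ ζ, Sd ζ = ∑ ζ' ∈ Z.filter (fun ζ' => ζ < ζ'), DZ ζ' := fun ζ => by simp only [hSd_def, hDZ_def]; exact hfib Dk ζ
  have hrec : ∀ ζ ∈ Z, DZ ζ ≤ QZ ζ * ηp - QZ ζ * (1 - 2 * t) * ∑ ζ' ∈ Z.filter (fun ζ' => ζ < ζ'), DZ ζ' := by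
    intro ζ _
    rw [← hSZ ζ]
    have : DZ ζ ≤ ∑ k ∈ A.filter (fun k => z k = ζ), qk k * (ηp - (1 - 2 * t) * Sd ζ) := by
      simp only [hDZ_def]
      refine sum_le_sum fun k hk => ?_
      obtain ⟨hkA, hzk⟩ := mem_filter.mp hk
      have := hage k hkA
      rw [hzk] at this
      exact this
    rw [← sum_mul] at this
    simp only [hQZ_def]
    linarith
  -- THE BUDGET RECURSION OVER THE ZONES and the assembly
  have htot : ∑ k ∈ A, Dk k = ∑ ζ ∈ Z, DZ ζ := by
    simp only [hDZ_def]; rw [sum_fiberwise_of_maps_to hmaps]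
  have hfin : B h - B h' ≤ η := by
    rw [hdrop0, htot]
    rcases A.eq_empty_or_nonempty with hA | hA
    · have : Z = ∅ := by rw [hZ_def, hA, Finset.image_empty]
      rw [this, sum_empty]; exact hη0
    · have hE0 := hZq hA
      have hZ1 : 1 ≤ Z.card := by obtain ⟨k, hk⟩ := hA; exact card_pos.mpr ⟨z k, hmaps k hk⟩
      have hEt : 0 ≤ E * t := mul_nonneg hE0 ht0
      have e4 : (E + 4) * t = E * t + 4 * t := by ring
      have h2t : 0 ≤ 1 - 2 * t := by linarith [hpowle, ht]
      have hθ : ∀ ζ ∈ Z, 0 ≤ 1 - QZ ζ * (1 - 2 * t) := by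
        intro ζ hζ; have : QZ ζ * (1 - 2 * t) ≤ 1 * 1 := mul_le_mul ((hQZq ζ hζ).trans hq1) (by linarith) h2t zero_le_one; linarith
      have hbud := budget_prod h2t Z (fun ζ _ => hDZ0 ζ) hθ hrec
      have hprod : (1 - q) ^ Z.card ≤ ∏ ζ ∈ Z, (1 - QZ ζ * (1 - 2 * t)) :=
        pow_card_le_prod_of_le Z (by linarith) fun ζ hζ => by
          have : QZ ζ * (1 - 2 * t) ≤ q * 1 := mul_le_mul (hQZq ζ hζ) (by linarith) h2t hq0
          linarith
      have hasm := assembly_general (E := E) ht0 hη0 (by linarith : (0:ℝ) ≤ 1 - q) hprod hE0 ht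
      have e : ηp * (1 - ∏ ζ ∈ Z, (1 - QZ ζ * (1 - 2 * t))) = η * (1 + E * t / 2) * (1 - ∏ ζ ∈ Z, (1 - QZ ζ * (1 - 2 * t))) := by
        simp only [hηp_def]
      have hchain : (1 - 2 * t) * ∑ ζ ∈ Z, DZ ζ ≤ (1 - 2 * t) * η := by linarith [hbud, hasm, e]
      rcases eq_or_lt_of_le h2t with h0 | hpos
      · -- degenerate separation t = 1/2: then q = 0 and every zone row vanishes
        have ht12 : t = 1 / 2 := by linarith
        have hq' : q = 0 := by
          have h1 : (E + 4) * t ≤ 2 * (1 - q) ^ Z.card := ht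
          rw [ht12] at h1
          have h3 : (1 - q) ^ Z.card ≤ (1 - q) := pow_le_of_le_one (by linarith) (by linarith) (by omega)
          refine le_antisymm ?_ hq0
          linarith
        have hZ0 : ∀ ζ ∈ Z, DZ ζ ≤ 0 := by
          intro ζ hζ
          have hQq := hQZq ζ hζ; rw [hq'] at hQq
          have hQ0 : QZ ζ = 0 := le_antisymm hQq (hQZ0 ζ)
          have hr := hrec ζ hζ; rw [hQ0, zero_mul, zero_mul, zero_mul, sub_zero] at hr; exact hr
        have : ∑ ζ ∈ Z, DZ ζ ≤ 0 := sum_nonpos hZ0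
        linarith
      · exact le_of_mul_le_mul_left hchain hpos
  rw [hη_def] at hfin
  linarith

/-! ## §2 The comparison theorem -/

/-- **PROFILE-BOUNDED HYPER-SEPARATED ZONES COMPARE AT ANY SIZE, UNIFORMLY IN THE NUMBER OF AGES** (family-free form of §1's step by (E63a)'s principle
`le_of_isotone_excess_of_step_below`): `B = b + Σ_{k<K} L_k·u_k` on ]0,γ] with `b > 0`, `L ≥ 0` supported on `{0} ∪ A`, `A ⊆ [1, K[` finite (Markov weight
ARBITRARY); a zone map `z` with `k ≤ t·k′` whenever `z k < z k′`; every zone passing `Σ_{j∈A, z j = ζ} L_j ∕ P_j ≤ 2q` (`0 ≤ q ≤ 1`);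
**`(3q(N−1) + 4)·t ≤ 2·(1 − q)^N`**, `N` the number of zones; `B′` with zeroth moment `M′ ≥ 0`, `B ≤ B′`, ISOTONE excess; `h`, `h′` ANY box solutions of `B`,
`B′` from one pin `p ∈ ]0,γ]`.  Then `h′ ≤ h` at EVERY scale.  (E62c) `le_of_isotone_excess_zones` is the case `L_0 = 0` with the stronger hypothesis
`(#A² + 4)·t ≤ 2(1−q)^N`. [folklore] -/
theorem le_of_isotone_excess_zones_uniform {p : ℝ} (hL : ∀ k, 0 ≤ L k) (hb : 0 < b) (hAK : A ⊆ range K) (hA1 : ∀ k ∈ A, 1 ≤ k)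
    (hsupp : ∀ k ∈ range K, k ∉ A → k ≠ 0 → L k = 0) (ht0 : 0 ≤ t) (hsep : ∀ k ∈ A, ∀ k' ∈ A, z k < z k' → (k : ℝ) ≤ t * k')
    (hq0 : 0 ≤ q) (hq1 : q ≤ 1)
    (hzone : ∀ ζ ∈ A.image z, ∑ j ∈ A.filter (fun j => z j = ζ), L j / ∑ k ∈ range K, L k * Real.sqrt ((j : ℝ) / ((j : ℝ) + k)) ≤ 2 * q)
    (ht : (3 * q * (((A.image z).card : ℝ) - 1) + 4) * t ≤ 2 * (1 - q) ^ (A.image z).card)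
    (hB' : ∀ u u' : ℕ → ℝ, SeqBox γ u → SeqBox γ u' → ∀ D : ℝ, (∀ j, |u j - u' j| ≤ D) → |B' u - B' u'| ≤ M' * D) (hM' : 0 ≤ M')
    (hexc : ∀ u, SeqBox γ u → (fun u : ℕ → ℝ => b + ∑ k ∈ range K, L k * u k) u ≤ B' u)
    (hDmono : ∀ u v : ℕ → ℝ, SeqBox γ u → SeqBox γ v → (∀ j, u j ≤ v j) →
      B' u - (fun u : ℕ → ℝ => b + ∑ k ∈ range K, L k * u k) u ≤ B' v - (fun u : ℕ → ℝ => b + ∑ k ∈ range K, L k * u k) v)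
    (hp : 0 < p) (hpγ : p ≤ γ) (hh : SeqBox γ h) (hf : MemFlow (fun u : ℕ → ℝ => b + ∑ k ∈ range K, L k * u k) p h)
    (hh' : SeqBox γ h') (hf' : MemFlow B' p h') (j : ℕ) : h' j ≤ h j :=
  le_of_isotone_excess_of_step_below (B := fun u : ℕ → ℝ => b + ∑ k ∈ range K, L k * u k) (affine_monotone hL)
    (affine_zerothMoment hL) (sum_nonneg fun k _ => hL k) hb (affine_floor hL) hB' hM' hexc hDmono
    (fun _ _ hS huniq hS' huniq' _ hy hyγ hdeep _ _ hu hfu hu' hfu' hle =>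
      effective_le_of_family_le_at_zones_uniform hL hb hAK hA1 hsupp ht0 hsep hq0 hq1 hzone ht hB' hM' hexc hDmono hS huniq hS' huniq'
        hy hyγ hdeep hu hfu hu' hfu' hle)
    hp hpγ hh hf hh' hf' j

end Summit.QuantumFields.BalabanUV.Beta.EriceRemainderEnclosureHistoryAutonomyComparisonZonesUniform

end
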